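import Literature.NumberTheory.CubicFields.ThreeTorsionMeanTwoAdicBridge
import Literature.NumberTheory.CubicFields.ThreeTorsionSumFirstOrderSieve
import HarnessLib

/-!
# Taniguchi–Thorne at the prime `2` (`tt_threeTorsion_twoAdic`): down to binary cubic forms, and the squarefree sieve at a fixed `2`-adic type

Topic `Literature/NumberTheory/CubicFields`, continuing `ThreeTorsionMeanTwoAdicBridge.lean` (which
reduces the named fact `QuadraticFields.tt_threeTorsion_twoAdic` — Taniguchi–Thorne 2013, Thm 4 with
§6.3 and Thm 25 at the prime `2` — to Hasse's dictionary and two-term counts / twisted bounds for the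
numbers `cubicFieldCountOfDisc D` of cubic fields of fundamental discriminant `D` in each `2`-adic type
`D ≡ rs (mod 8r)`). This file carries out the next two steps OF THE PRINTED PROOF on the tree's
genuine objects (Taniguchi–Thorne arXiv:1102.2914, §6.1: "we use the following classical result of
Hasse … It therefore suffices to count cubic fields which are nowhere totally ramified. … We may count
these fields by replacing the `q`-nonmaximal zeta functions with '`q`-nonmaximal-or-totally-ramified'
zeta functions; … we shrink the set `U_p` … to a new set `V_p` … By Proposition (5.x) we have
`M₃^±(X) = ½ Σ_{q ≥ 1} μ(q) (Σ_{n ≤ X} a'_q(n)) − (3/π²) X + O(X^{1/2})`"; Bhargava–Taniguchi–Thorne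
2023 §5 for the same sieve with `Ψ_{q²}` = "`p² ∣ Disc` for `p ∣ q`"):

* **Step 1 (cubic fields → orbits of forms).** `tt_threeTorsion_twoAdic_of_hasse_of_irredOrbitCount`:
  by Delone–Faddeev / Davenport–Heilbronn the cubic fields of fundamental discriminant `D` are the
  `GL₂(ℤ)`-orbits of irreducible integral binary cubic forms of discriminant `D`
  (`cubicFieldCountOfDisc_eq_card_irredOrbitsOfDisc`, `ThreeTorsionSumFirstOrder.lean`), so the
  hypotheses of the bridge may be stated with `#irredOrbitsOfDisc D`.
* **Step 2 (arithmetic of the eight types).** On an admissible type `(r, s)` (`r ∈ {1, 4, 8}`,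
  `s` odd `mod 8`, `e(rs, 2) = 1`): the local condition at `2` for fundamentality is automatic
  (`isFundAt_two_of_modEq_type`), `D = r · (D/r)` with `D/r` odd, and
  **`D` is fundamental ⟺ `D ≠ 1` and `D/r` is squarefree** (`isFundamental_iff_squarefree_ediv_of_modEq_type`);
  hence `𝟙_{fund}(D) = Σ_{q odd, q² ∣ D} μ(q)` on the type (`ite_squarefree_ediv_eq_sum_moebius_of_modEq_type`:
  only ODD `q` occur — the prime `2` is absorbed by the type, as in the paper, where the local
  specification at `2` is fixed and the sieve runs over `q` coprime to it).
* **Step 3 (the squarefree sieve at a fixed type, any weight).**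
  `sum_filter_isFundamental_eq_sum_moebius_of_modEq_type` and its two window forms
  `sum_negFundDiscrs_type_eq_sum_moebius`, `sum_posFundDiscrs_type_eq_sum_moebius`:
  `Σ_{0<∓D<X fund., D ≡ rs (8r)} w(D) = Σ_{q ≤ X odd} μ(q) Σ_{0<∓D<X, D ≡ rs (8r), q² ∣ D} w(D)`
  (for `D > 0` with `w(1) = 0`; the weight may be complex, e.g. `ψ(D/r) · #irredOrbitsOfDisc D` for the
  twisted sums of Thm 25).
* **Step 4 (the sieved counts are orbit counts with congruence conditions).**
  `irredOrbitCount_setOf_disc_eq_sum` and `sum_negFundDiscrs_type_irredOrbits_eq_sum_moebius` /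
  `sum_posFundDiscrs_type_irredOrbits_eq_sum_moebius`:
  `Σ_{0<∓D<X fund., D ≡ rs (8r)} #irredOrbitsOfDisc D = Σ_{q ≤ X odd} μ(q) · N^∓_q(X; r, s)` with
  `N^∓_q(X; r, s) = irredOrbitCount (∓1) {f | Disc f ≡ rs (8r), q² ∣ Disc f} X`, BST's `N(S; X)` of
  `ThreeTorsionSumFirstOrderSieve.lean` for the set `S` of forms with `Disc ≡ rs (mod 8r)` and
  `q² ∣ Disc` — the irreducible part of the partial sums `Σ_{n<X} a'_q(n)` of Taniguchi–Thorne's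
  `q`-nonmaximal-or-totally-ramified Shintani zeta function with the local specification at `2`
  (for odd `p`, "`f ∉ V_p`" is "`p² ∣ Disc f`": `sq_dvd_disc_of_not_isFundAt`), equivalently
  Bhargava–Taniguchi–Thorne's `N^∓(X, Φ ⊗ Ψ_{q²})`.

So after this file `tt_threeTorsion_twoAdic_holds` needs exactly: Hasse's dictionary (named fact
`threeTorsion_eq_two_mul_cubicFieldCountOfDisc_add_one`), and the analytic core of the paper for the
congruence counting functions `N^±_q(X; r, s)` (two-term expansions from the Shintani zeta functions
with their residues, Thm 10 / [TT_L]; the error analysis of §5 with `Q = X^{5/23}`; uniformity in `q`,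
Lemma 3.3 of Belabas–Bhargava–Pomerance = the tree's named fact `btt_uniformity_sqDvd`) and their
`ψ(Disc/r)`-twists (orbital `L`-functions, Thm 25). Nothing here is a new named fact.

## References

* T. Taniguchi, F. Thorne, *Secondary terms in counting functions for cubic fields*, Duke Math. J.
  162 (2013) 2451–2508 = arXiv:1102.2914, §6.1 (Hasse; `V_p`; the Möbius reduction), §6.3, §6.4
  (`r`, `Disc(K)/r`), Thm 25 [TaniguchiThorne2013].
* M. Bhargava, T. Taniguchi, F. Thorne, *Improved error estimates for the Davenport–Heilbronn
  theorems*, Math. Ann. 389 (2024) = arXiv:2107.12819, (3) and §5 (`Ψ_{q²}`) [BhargavaTaniguchiThorne2023].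
* M. Bhargava, A. Shankar, J. Tsimerman, Invent. Math. 193 (2013) = arXiv:1005.0672, §8.2, §8.5
  [BhargavaShankarTsimerman2012].
-/

noncomputable section

open Finset
open scoped ArithmeticFunction.Moebius

namespace Literature.NumberTheory.CubicFields

open BinaryCubic Literature.NumberTheory.QuadraticFields
open Literature.NumberTheory.LFunctions (sqfreeInd sqfreeInd_eq_sum_moebius)

/-! ### Step 1 (TT §6.1 + Delone–Faddeev/Davenport–Heilbronn): from cubic fields to orbits of irreducible forms -/

/-- On the `2`-adic type classes of `negFundDiscrs X` the number of cubic fields of discriminant `D`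
is the number of `GL₂(ℤ)`-orbits of irreducible integral binary cubic forms of discriminant `D`
(`cubicFieldCountOfDisc_eq_card_irredOrbitsOfDisc`, fundamental `D`). [folklore] -/
theorem sum_filter_negFundDiscrs_cubicFieldCountOfDisc {M : Type*} [AddCommMonoid M]
    (g : ℤ → ℕ → M) (p : ℤ → Prop) [DecidablePred p] (X : ℕ) :
    ∑ D ∈ (negFundDiscrs X).filter p, g D (cubicFieldCountOfDisc D) =
      ∑ D ∈ (negFundDiscrs X).filter p, g D (Nat.card (irredOrbitsOfDisc D)) :=
  Finset.sum_congr rfl fun D hD => by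
    rw [cubicFieldCountOfDisc_eq_card_irredOrbitsOfDisc (mem_negFundDiscrs.1 (Finset.mem_filter.1 hD).1).2]

/-- The same over `posFundDiscrs X`. [folklore] -/
theorem sum_filter_posFundDiscrs_cubicFieldCountOfDisc {M : Type*} [AddCommMonoid M]
    (g : ℤ → ℕ → M) (p : ℤ → Prop) [DecidablePred p] (X : ℕ) :
    ∑ D ∈ (posFundDiscrs X).filter p, g D (cubicFieldCountOfDisc D) =
      ∑ D ∈ (posFundDiscrs X).filter p, g D (Nat.card (irredOrbitsOfDisc D)) :=
  Finset.sum_congr rfl fun D hD => by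
    rw [cubicFieldCountOfDisc_eq_card_irredOrbitsOfDisc (mem_posFundDiscrs.1 (Finset.mem_filter.1 hD).1).2]

/-- **`tt_threeTorsion_twoAdic` from Hasse's dictionary and two-term counts of `GL₂(ℤ)`-orbits of
irreducible binary cubic forms of fundamental discriminant in each `2`-adic type** (Taniguchi–Thorne
§6.1: "It therefore suffices to count cubic fields which are nowhere totally ramified", i.e. of
fundamental discriminant, and these are — Delone–Faddeev / Davenport–Heilbronn, "we will not say any
more about the Davenport–Heilbronn and Delone–Faddeev correspondences" — the `GL₂(ℤ)`-orbits of
irreducible integral binary cubic forms of that discriminant: `cubicFieldCountOfDisc_eq_card_irredOrbitsOfDisc`).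
Hypotheses: `h₁` the dictionary (named fact); `hcount` — for every admissible type `(r, s)`,
`Σ_{-X<D<0 fund., D ≡ rs (8r)} #irredOrbitsOfDisc D = X/(2rπ²) + K⁻X^{5/6} + O_ε(X^{18/23+ε})` and
`Σ_{0<D<X fund., D ≡ rs (8r)} #irredOrbitsOfDisc D = X/(6rπ²) + K⁺X^{5/6} + O_ε(X^{18/23+ε})`
(Thm 4 with §6.3 for `M₃^±(X, 𝒮₂)`); `htwist` — the `ψ(D/r)`-twisted sums of the same orbit numbers are
`O_ε(X^{18/23+ε})` for primitive `ψ (mod 2ʲ)`, `j ≥ 4`, `ψ⁶ ≠ 1` (Thm 25). [cite: TaniguchiThorne2013, §6.1 with Theorem 4 (§6.3) and Theorem 25] -/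
theorem tt_threeTorsion_twoAdic_of_hasse_of_irredOrbitCount
    (h₁ : threeTorsion_eq_two_mul_cubicFieldCountOfDisc_add_one)
    (hcount : ∀ r ∈ ({1, 4, 8} : Finset ℕ), ∀ s ∈ ({1, 3, 5, 7} : Finset ℤ),
      ttLocalFactorTwo (r * s) = 1 →
      (∃ K : ℝ, ∀ ε : ℝ, 0 < ε → ∃ C : ℝ, ∀ X : ℕ, 1 ≤ X →
        |(∑ D ∈ (negFundDiscrs X).filter (fun D => D ≡ r * s [ZMOD ((8 * r : ℕ) : ℤ)]),
            (Nat.card (irredOrbitsOfDisc D) : ℝ)) - 1 / (2 * r * Real.pi ^ 2) * X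
            - K * (X : ℝ) ^ ((5 : ℝ) / 6)| ≤ C * (X : ℝ) ^ ((18 : ℝ) / 23 + ε)) ∧
      (∃ K : ℝ, ∀ ε : ℝ, 0 < ε → ∃ C : ℝ, ∀ X : ℕ, 1 ≤ X →
        |(∑ D ∈ (posFundDiscrs X).filter (fun D => D ≡ r * s [ZMOD ((8 * r : ℕ) : ℤ)]),
            (Nat.card (irredOrbitsOfDisc D) : ℝ)) - 1 / (6 * r * Real.pi ^ 2) * X
            - K * (X : ℝ) ^ ((5 : ℝ) / 6)| ≤ C * (X : ℝ) ^ ((18 : ℝ) / 23 + ε)))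
    (htwist : ∀ r ∈ ({1, 4, 8} : Finset ℕ), ∀ s ∈ ({1, 3, 5, 7} : Finset ℤ),
      ttLocalFactorTwo (r * s) = 1 → ∀ j : ℕ, 4 ≤ j → ∀ ψ : DirichletCharacter ℂ (2 ^ j),
      ψ.IsPrimitive → ψ ^ 6 ≠ 1 →
      (∀ ε : ℝ, 0 < ε → ∃ C : ℝ, ∀ X : ℕ, 1 ≤ X →
        ‖∑ D ∈ (negFundDiscrs X).filter (fun D => D ≡ r * s [ZMOD ((8 * r : ℕ) : ℤ)]),
            ψ (((D / (r : ℤ) : ℤ)) : ZMod (2 ^ j)) * (Nat.card (irredOrbitsOfDisc D) : ℂ)‖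
          ≤ C * (X : ℝ) ^ ((18 : ℝ) / 23 + ε)) ∧
      (∀ ε : ℝ, 0 < ε → ∃ C : ℝ, ∀ X : ℕ, 1 ≤ X →
        ‖∑ D ∈ (posFundDiscrs X).filter (fun D => D ≡ r * s [ZMOD ((8 * r : ℕ) : ℤ)]),
            ψ (((D / (r : ℤ) : ℤ)) : ZMod (2 ^ j)) * (Nat.card (irredOrbitsOfDisc D) : ℂ)‖
          ≤ C * (X : ℝ) ^ ((18 : ℝ) / 23 + ε))) :
    tt_threeTorsion_twoAdic := by
  refine tt_threeTorsion_twoAdic_of_hasse_of_cubicFieldCount h₁ (fun r hr s hs he => ?_)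
    (fun r hr s hs he j hj ψ hψ hψ6 => ?_)
  · obtain ⟨⟨K, hK⟩, ⟨K', hK'⟩⟩ := hcount r hr s hs he
    refine ⟨⟨K, fun ε hε => ?_⟩, ⟨K', fun ε hε => ?_⟩⟩
    · obtain ⟨C, hC⟩ := hK ε hε
      refine ⟨C, fun X hX => ?_⟩
      rw [sum_filter_negFundDiscrs_cubicFieldCountOfDisc (fun _ n => (n : ℝ))]
      exact hC X hX
    · obtain ⟨C, hC⟩ := hK' ε hε
      refine ⟨C, fun X hX => ?_⟩
      rw [sum_filter_posFundDiscrs_cubicFieldCountOfDisc (fun _ n => (n : ℝ))]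
      exact hC X hX
  · obtain ⟨hn, hp⟩ := htwist r hr s hs he j hj ψ hψ hψ6
    refine ⟨fun ε hε => ?_, fun ε hε => ?_⟩
    · obtain ⟨C, hC⟩ := hn ε hε
      refine ⟨C, fun X hX => ?_⟩
      rw [sum_filter_negFundDiscrs_cubicFieldCountOfDisc
        (fun D n => ψ (((D / (r : ℤ) : ℤ)) : ZMod (2 ^ j)) * (n : ℂ))]
      exact hC X hX
    · obtain ⟨C, hC⟩ := hp ε hε
      refine ⟨C, fun X hX => ?_⟩
      rw [sum_filter_posFundDiscrs_cubicFieldCountOfDisc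
        (fun D n => ψ (((D / (r : ℤ) : ℤ)) : ZMod (2 ^ j)) * (n : ℂ))]
      exact hC X hX

/-! ### Step 2: arithmetic of the eight types -/

/-- On an admissible type the local condition at `2` for a fundamental discriminant holds
automatically: `D ≡ rs (mod 8r)` gives `D ≡ 1 (mod 4)` (`r = 1`, `s ∈ {1, 5}`), `D ≡ 12 (mod 16)`
(`r = 4`, `s ∈ {3, 7}`) or `D ≡ 8 (mod 16)` (`r = 8`). [cite: TaniguchiThorne2013, §6.3 (a specification at 2 is determined by D (mod 64))] -/
theorem isFundAt_two_of_modEq_type {r : ℕ} {s : ℤ} (hr : r ∈ ({1, 4, 8} : Finset ℕ))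
    (hs : s ∈ ({1, 3, 5, 7} : Finset ℤ)) (he : ttLocalFactorTwo (r * s) = 1) {D : ℤ}
    (hD : D ≡ r * s [ZMOD ((8 * r : ℕ) : ℤ)]) : IsFundAt 2 D := by
  rw [ttLocalFactorTwo_mul_eq_one_iff hr hs] at he
  rw [isFundAt_two]
  simp only [Finset.mem_insert, Finset.mem_singleton] at hs
  unfold Int.ModEq at hD
  rcases he with ⟨rfl, rfl | rfl⟩ | ⟨rfl, rfl | rfl⟩ | rfl
  · push_cast at hD; omega
  · push_cast at hD; omega
  · push_cast at hD; omega
  · push_cast at hD; omega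
  · push_cast at hD
    rcases hs with rfl | rfl | rfl | rfl <;> omega

/-- `D ≠ 0` on a type (`s` is odd). [folklore] -/
theorem ne_zero_of_modEq_type {r : ℕ} {s : ℤ} (hr : r ∈ ({1, 4, 8} : Finset ℕ))
    (hs : s ∈ ({1, 3, 5, 7} : Finset ℤ)) {D : ℤ} (hD : D ≡ r * s [ZMOD ((8 * r : ℕ) : ℤ)]) : D ≠ 0 := by
  simp only [Finset.mem_insert, Finset.mem_singleton] at hr hs
  unfold Int.ModEq at hD
  rcases hr with rfl | rfl | rfl <;> rcases hs with rfl | rfl | rfl | rfl <;>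
    · push_cast at hD; omega

/-- `D = r · (D / r)` on a type. [folklore] -/
theorem eq_mul_ediv_of_modEq_type {r : ℕ} {s : ℤ} (hr : r ∈ ({1, 4, 8} : Finset ℕ))
    {D : ℤ} (hD : D ≡ r * s [ZMOD ((8 * r : ℕ) : ℤ)]) :
    D = (r : ℤ) * (D / (r : ℤ)) := by
  simp only [Finset.mem_insert, Finset.mem_singleton] at hr
  unfold Int.ModEq at hD
  rcases hr with rfl | rfl | rfl
  · simp
  · push_cast at hD ⊢; omega
  · push_cast at hD ⊢; omega

/-- **Fundamental ⟺ `D/r` squarefree (and `D ≠ 1`) on a type.** For `D ≡ rs (mod 8r)` admissible: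
`r = 1`: `D ≡ 1 (mod 4)` and fundamental means `D` squarefree, `D ≠ 1`; `r = 4`: `D = 4m`,
`m ≡ 3 (mod 4)`, fundamental means `m` squarefree; `r = 8`: `D = 4 · 2m'`, `m'` odd, and `2m'` is
squarefree iff `m'` is. (The paper's `r ∣ Disc K` with `Disc(K)/r` the part seen by `χ`, §6.4.) [cite: TaniguchiThorne2013, §6.3–6.4] -/
theorem isFundamental_iff_squarefree_ediv_of_modEq_type {r : ℕ} {s : ℤ} (hr : r ∈ ({1, 4, 8} : Finset ℕ))
    (hs : s ∈ ({1, 3, 5, 7} : Finset ℤ)) (he : ttLocalFactorTwo (r * s) = 1) {D : ℤ}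
    (hD : D ≡ r * s [ZMOD ((8 * r : ℕ) : ℤ)]) :
    ((D % 4 = 1 ∧ Squarefree D ∧ D ≠ 1) ∨ (4 ∣ D ∧ (D / 4 % 4 = 2 ∨ D / 4 % 4 = 3) ∧ Squarefree (D / 4))) ↔
      D ≠ 1 ∧ Squarefree (D / (r : ℤ)) := by
  rw [ttLocalFactorTwo_mul_eq_one_iff hr hs] at he
  simp only [Finset.mem_insert, Finset.mem_singleton] at hs
  unfold Int.ModEq at hD
  rcases he with ⟨rfl, rfl | rfl⟩ | ⟨rfl, rfl | rfl⟩ | rfl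
  · push_cast at hD
    simp only [Nat.cast_one, Int.ediv_one]
    constructor
    · rintro (⟨-, h2, h3⟩ | ⟨h4, -, -⟩)
      · exact ⟨h3, h2⟩
      · omega
    · rintro ⟨h1, h2⟩
      exact Or.inl ⟨by omega, h2, h1⟩
  · push_cast at hD
    simp only [Nat.cast_one, Int.ediv_one]
    constructor
    · rintro (⟨-, h2, h3⟩ | ⟨h4, -, -⟩)
      · exact ⟨h3, h2⟩
      · omega
    · rintro ⟨h1, h2⟩
      exact Or.inl ⟨by omega, h2, h1⟩
  · push_cast at hD ⊢
    constructor
    · rintro (⟨h1, -, -⟩ | ⟨-, -, h3⟩)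
      · omega
      · exact ⟨by omega, h3⟩
    · rintro ⟨-, h2⟩
      exact Or.inr ⟨by omega, by omega, h2⟩
  · push_cast at hD ⊢
    constructor
    · rintro (⟨h1, -, -⟩ | ⟨-, -, h3⟩)
      · omega
      · exact ⟨by omega, h3⟩
    · rintro ⟨-, h2⟩
      exact Or.inr ⟨by omega, by omega, h2⟩
  · push_cast at hD ⊢
    have hs2 : s % 2 = 1 := by rcases hs with rfl | rfl | rfl | rfl <;> norm_num
    have h8 : D = 8 * (D / 8) := by omega
    have hodd : D / 8 % 2 = 1 := by omega
    have h4 : D / 4 = 2 * (D / 8) := by omega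
    have hsq : Squarefree (D / 4) ↔ Squarefree (D / 8) := by
      rw [h4, ← Int.squarefree_natAbs, Int.natAbs_mul, ← Int.squarefree_natAbs (n := D / 8)]
      have hco : Nat.Coprime 2 (D / 8).natAbs := by
        rw [Nat.coprime_two_left, Int.natAbs_odd, Int.odd_iff]
        exact hodd
      rw [show (2 : ℤ).natAbs = 2 by rfl, Nat.squarefree_mul hco]
      exact ⟨fun h => h.2, fun h => ⟨Nat.prime_two.prime.squarefree, h⟩⟩
    constructor
    · rintro (⟨h1, -, -⟩ | ⟨-, -, h3⟩)
      · omega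
      · exact ⟨by omega, hsq.1 h3⟩
    · rintro ⟨-, h2⟩
      exact Or.inr ⟨by omega, by omega, hsq.2 h2⟩

/-! ### Step 3: the squarefree sieve at a fixed type (Möbius over odd `q`) -/

/-- The Möbius identity `Σ_{d ≤ N, d² ∣ n} μ(d) = 𝟙_{squarefree}(n)` (`0 < n ≤ N`), over `ℤ`
(from the tree's real-valued `sqfreeInd_eq_sum_moebius`). [folklore] -/
theorem sum_moebius_filter_sq_dvd_eq_ite {n N : ℕ} (hn : 0 < n) (hnN : n ≤ N) :
    ∑ d ∈ (Icc 1 N).filter (fun d => d ^ 2 ∣ n), (μ d : ℤ) = if Squarefree n then 1 else 0 := by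
  have h := sqfreeInd_eq_sum_moebius hn hnN
  simp only [sqfreeInd] at h
  have h' : (((∑ d ∈ (Icc 1 N).filter (fun d => d ^ 2 ∣ n), (μ d : ℤ)) : ℤ) : ℝ) =
      ((if Squarefree n then 1 else 0 : ℤ) : ℝ) := by
    push_cast
    rw [← h]
  exact_mod_cast h'

/-- **`𝟙_{D/r squarefree} = Σ_{q odd, q² ∣ D} μ(q)` on a type**: `D/r` is odd, so only odd `q` divide
it squarely, and for odd `q`, `q² ∣ D/r ⟺ q² ∣ D`. (`|D| ≤ N` bounds the range of `q`.) [folklore] -/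
theorem ite_squarefree_ediv_eq_sum_moebius_of_modEq_type {r : ℕ} {s : ℤ} (hr : r ∈ ({1, 4, 8} : Finset ℕ))
    (hs : s ∈ ({1, 3, 5, 7} : Finset ℤ)) {D : ℤ} (hD : D ≡ r * s [ZMOD ((8 * r : ℕ) : ℤ)]) {N : ℕ}
    (hN : D.natAbs ≤ N) :
    (if Squarefree (D / (r : ℤ)) then (1 : ℤ) else 0) =
      ∑ d ∈ (Icc 1 N).filter (fun d : ℕ => ¬ 2 ∣ d ∧ (d : ℤ) ^ 2 ∣ D), (μ d : ℤ) := by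
  set m : ℤ := D / (r : ℤ) with hm
  have hDm : D = (r : ℤ) * m := eq_mul_ediv_of_modEq_type hr hD
  have hmodd : m % 2 = 1 := ediv_emod_two_eq_one_of_modEq_type hr hs hD
  have hD0 : D ≠ 0 := ne_zero_of_modEq_type hr hs hD
  have hm0 : m ≠ 0 := by rintro h0; rw [h0, mul_zero] at hDm; exact hD0 hDm
  have hr1 : 1 ≤ r := by
    simp only [Finset.mem_insert, Finset.mem_singleton] at hr
    rcases hr with rfl | rfl | rfl <;> norm_num
  have hmN : m.natAbs ≤ N := by
    refine le_trans ?_ hN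
    rw [hDm, Int.natAbs_mul, Int.natAbs_natCast]
    exact Nat.le_mul_of_pos_left _ hr1
  have hgcd : ∀ d : ℕ, ¬ 2 ∣ d → Int.gcd ((d : ℤ) ^ 2) (r : ℤ) = 1 := by
    intro d hd
    have hodd : Odd d := Nat.odd_iff.2 (by omega)
    have hc2 : Nat.Coprime d 2 := (Nat.coprime_two_left.2 hodd).symm
    have hc : Nat.Coprime (d ^ 2) r := by
      simp only [Finset.mem_insert, Finset.mem_singleton] at hr
      rcases hr with rfl | rfl | rfl
      · exact Nat.coprime_one_right _
      · simpa using hc2.pow 2 2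
      · simpa using hc2.pow 2 3
    have : Int.gcd ((d ^ 2 : ℕ) : ℤ) (r : ℤ) = 1 := by rw [Int.gcd_natCast_natCast]; exact hc
    exact_mod_cast this
  rw [if_congr (Int.squarefree_natAbs (n := m)).symm rfl rfl,
    ← sum_moebius_filter_sq_dvd_eq_ite (Int.natAbs_pos.2 hm0) hmN]
  refine Finset.sum_congr ?_ fun _ _ => rfl
  ext d
  simp only [Finset.mem_filter, and_congr_right_iff]
  intro _
  have hdm : d ^ 2 ∣ m.natAbs ↔ (d : ℤ) ^ 2 ∣ m := by
    rw [← Int.natCast_dvd, Nat.cast_pow]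
  rw [hdm]
  constructor
  · intro h
    refine ⟨fun h2 => ?_, h.trans ⟨r, by rw [hDm]; ring⟩⟩
    obtain ⟨e, rfl⟩ := h2
    obtain ⟨k, hk⟩ := h
    have h2m : (2 : ℤ) ∣ m := ⟨2 * (e : ℤ) ^ 2 * k, by rw [hk]; push_cast; ring⟩
    omega
  · rintro ⟨h2, hdD⟩
    rw [hDm] at hdD
    exact Int.dvd_of_dvd_mul_right_of_gcd_one hdD (hgcd d h2)

/-- **The squarefree sieve at a fixed `2`-adic type** (the Möbius sum of Taniguchi–Thorne's reduction
`M₃^±(X) = ½ Σ_{q ≥ 1} μ(q) (Σ_{n ≤ X} a'_q(n)) − …`, §6.1 with Prop. 5.x, restricted to one type at `2`,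
where only odd `q` occur; Bhargava–Taniguchi–Thorne's `Ψ_{q²}` = "`p² ∣ Disc`", §5). For a finset `S`
of integers on the type `(r, s)` not containing `1`, with `|D| ≤ N` on `S`, and any weight `w`:
`Σ_{D ∈ S fundamental} w(D) = Σ_{q ≤ N odd} μ(q) Σ_{D ∈ S, q² ∣ D} w(D)`.
[cite: TaniguchiThorne2013, §6.1 (reduction of M₃^±(X) to the q-nonmaximal-or-totally-ramified counts)] -/
theorem sum_filter_isFundamental_eq_sum_moebius_of_modEq_type {R : Type*} [CommRing R] {r : ℕ} {s : ℤ}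
    (hr : r ∈ ({1, 4, 8} : Finset ℕ)) (hs : s ∈ ({1, 3, 5, 7} : Finset ℤ))
    (he : ttLocalFactorTwo (r * s) = 1) {S : Finset ℤ}
    (hS : ∀ D ∈ S, D ≡ r * s [ZMOD ((8 * r : ℕ) : ℤ)]) (h1 : (1 : ℤ) ∉ S) {N : ℕ}
    (hN : ∀ D ∈ S, D.natAbs ≤ N) (w : ℤ → R) :
    ∑ D ∈ S.filter (fun D => (D % 4 = 1 ∧ Squarefree D ∧ D ≠ 1) ∨
        (4 ∣ D ∧ (D / 4 % 4 = 2 ∨ D / 4 % 4 = 3) ∧ Squarefree (D / 4))), w D =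
      ∑ d ∈ (Icc 1 N).filter (fun d => ¬ 2 ∣ d), (μ d : R) * ∑ D ∈ S.filter (fun D => (d : ℤ) ^ 2 ∣ D), w D := by
  classical
  rw [Finset.sum_filter]
  have key : ∀ D ∈ S, (if (D % 4 = 1 ∧ Squarefree D ∧ D ≠ 1) ∨
        (4 ∣ D ∧ (D / 4 % 4 = 2 ∨ D / 4 % 4 = 3) ∧ Squarefree (D / 4)) then w D else 0) =
      ∑ d ∈ (Icc 1 N).filter (fun d => ¬ 2 ∣ d), (if (d : ℤ) ^ 2 ∣ D then (μ d : R) * w D else 0) := by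
    intro D hD
    have hiff := isFundamental_iff_squarefree_ediv_of_modEq_type hr hs he (hS D hD)
    have hD1 : D ≠ 1 := fun h => h1 (h ▸ hD)
    have h2 := ite_squarefree_ediv_eq_sum_moebius_of_modEq_type hr hs (hS D hD) (hN D hD)
    have h3 : (if (D % 4 = 1 ∧ Squarefree D ∧ D ≠ 1) ∨
        (4 ∣ D ∧ (D / 4 % 4 = 2 ∨ D / 4 % 4 = 3) ∧ Squarefree (D / 4)) then w D else 0) =
        ((if Squarefree (D / (r : ℤ)) then (1 : ℤ) else 0 : ℤ) : R) * w D := by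
      rw [if_congr hiff rfl rfl]
      by_cases hsq : Squarefree (D / (r : ℤ))
      · simp [hsq, hD1]
      · simp [hsq]
    rw [h3, h2]
    push_cast
    rw [Finset.sum_mul, ← Finset.filter_filter, Finset.sum_filter]
  rw [Finset.sum_congr rfl key, Finset.sum_comm]
  refine Finset.sum_congr rfl fun d _ => ?_
  rw [Finset.sum_filter, Finset.mul_sum]
  refine Finset.sum_congr rfl fun D _ => ?_
  split_ifs <;> simp

/-- The type classes inside `negFundDiscrs X` are the fundamental elements of the type class of the
window `discWindow (-1) X` = `(−X, 0)`. [folklore] -/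
theorem filter_negFundDiscrs_type_eq (r : ℕ) (s : ℤ) (X : ℕ) :
    (negFundDiscrs X).filter (fun D => D ≡ r * s [ZMOD ((8 * r : ℕ) : ℤ)]) =
      ((discWindow (-1) X).filter (fun D => D ≡ r * s [ZMOD ((8 * r : ℕ) : ℤ)])).filter
        (fun D => (D % 4 = 1 ∧ Squarefree D ∧ D ≠ 1) ∨
          (4 ∣ D ∧ (D / 4 % 4 = 2 ∨ D / 4 % 4 = 3) ∧ Squarefree (D / 4))) := by
  ext D
  simp only [Finset.mem_filter, mem_negFundDiscrs, mem_discWindow (Or.inr rfl)]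
  constructor
  · rintro ⟨⟨hw, hf⟩, ht⟩
    exact ⟨⟨⟨by omega, by omega⟩, ht⟩, hf⟩
  · rintro ⟨⟨hw, ht⟩, hf⟩
    exact ⟨⟨⟨by omega, by omega⟩, hf⟩, ht⟩

/-- The type classes inside `posFundDiscrs X`: the fundamental elements of the type class of
`discWindow 1 X` = `(0, X)` with `1` removed (it is never fundamental). [folklore] -/
theorem filter_posFundDiscrs_type_eq (r : ℕ) (s : ℤ) (X : ℕ) :
    (posFundDiscrs X).filter (fun D => D ≡ r * s [ZMOD ((8 * r : ℕ) : ℤ)]) =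
      (((discWindow 1 X).filter (fun D => D ≡ r * s [ZMOD ((8 * r : ℕ) : ℤ)])).erase 1).filter
        (fun D => (D % 4 = 1 ∧ Squarefree D ∧ D ≠ 1) ∨
          (4 ∣ D ∧ (D / 4 % 4 = 2 ∨ D / 4 % 4 = 3) ∧ Squarefree (D / 4))) := by
  ext D
  simp only [Finset.mem_filter, Finset.mem_erase, mem_posFundDiscrs, mem_discWindow (Or.inl rfl)]
  constructor
  · rintro ⟨⟨hw, hf⟩, ht⟩
    have h1 : D ≠ 1 := ((isFundamental_iff_forall_isFundAt D).1 hf).1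
    exact ⟨⟨h1, ⟨by omega, by omega⟩, ht⟩, hf⟩
  · rintro ⟨⟨-, hw, ht⟩, hf⟩
    exact ⟨⟨⟨by omega, by omega⟩, hf⟩, ht⟩

/-- **The sieve for `Σ_{−X<D<0 fund., D ≡ rs (8r)} w(D)`** (any weight): it equals
`Σ_{q ≤ X odd} μ(q) Σ_{−X<D<0, D ≡ rs (8r), q² ∣ D} w(D)`.
[cite: TaniguchiThorne2013, §6.1 (reduction of M₃^±(X) to the q-nonmaximal-or-totally-ramified counts)] -/
theorem sum_negFundDiscrs_type_eq_sum_moebius {R : Type*} [CommRing R] {r : ℕ} {s : ℤ}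
    (hr : r ∈ ({1, 4, 8} : Finset ℕ)) (hs : s ∈ ({1, 3, 5, 7} : Finset ℤ))
    (he : ttLocalFactorTwo (r * s) = 1) (w : ℤ → R) (X : ℕ) :
    ∑ D ∈ (negFundDiscrs X).filter (fun D => D ≡ r * s [ZMOD ((8 * r : ℕ) : ℤ)]), w D =
      ∑ d ∈ (Icc 1 X).filter (fun d => ¬ 2 ∣ d), (μ d : R) *
        ∑ D ∈ (discWindow (-1) X).filter
          (fun D => D ≡ r * s [ZMOD ((8 * r : ℕ) : ℤ)] ∧ (d : ℤ) ^ 2 ∣ D), w D := by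
  classical
  rw [filter_negFundDiscrs_type_eq,
    sum_filter_isFundamental_eq_sum_moebius_of_modEq_type hr hs he (N := X)
      (fun D hD => (Finset.mem_filter.1 hD).2)
      (fun h => by
        have := (mem_discWindow (Or.inr rfl)).1 (Finset.mem_filter.1 h).1
        omega)
      (fun D hD => by
        have := (mem_discWindow (Or.inr rfl)).1 (Finset.mem_filter.1 hD).1
        omega) w]
  simp only [Finset.filter_filter]

/-- **The sieve for `Σ_{0<D<X fund., D ≡ rs (8r)} w(D)`** (any weight with `w(1) = 0`): it equals
`Σ_{q ≤ X odd} μ(q) Σ_{0<D<X, D ≡ rs (8r), q² ∣ D} w(D)`.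
[cite: TaniguchiThorne2013, §6.1 (reduction of M₃^±(X) to the q-nonmaximal-or-totally-ramified counts)] -/
theorem sum_posFundDiscrs_type_eq_sum_moebius {R : Type*} [CommRing R] {r : ℕ} {s : ℤ}
    (hr : r ∈ ({1, 4, 8} : Finset ℕ)) (hs : s ∈ ({1, 3, 5, 7} : Finset ℤ))
    (he : ttLocalFactorTwo (r * s) = 1) {w : ℤ → R} (hw : w 1 = 0) (X : ℕ) :
    ∑ D ∈ (posFundDiscrs X).filter (fun D => D ≡ r * s [ZMOD ((8 * r : ℕ) : ℤ)]), w D =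
      ∑ d ∈ (Icc 1 X).filter (fun d => ¬ 2 ∣ d), (μ d : R) *
        ∑ D ∈ (discWindow 1 X).filter
          (fun D => D ≡ r * s [ZMOD ((8 * r : ℕ) : ℤ)] ∧ (d : ℤ) ^ 2 ∣ D), w D := by
  classical
  rw [filter_posFundDiscrs_type_eq,
    sum_filter_isFundamental_eq_sum_moebius_of_modEq_type hr hs he (N := X)
      (fun D hD => (Finset.mem_filter.1 (Finset.mem_erase.1 hD).2).2)
      (fun h => (Finset.mem_erase.1 h).1 rfl)
      (fun D hD => by
        have := (mem_discWindow (Or.inl rfl)).1 (Finset.mem_filter.1 (Finset.mem_erase.1 hD).2).1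
        omega) w]
  refine Finset.sum_congr rfl fun d _ => ?_
  congr 1
  rw [Finset.filter_erase, Finset.sum_erase _ (by simpa using hw), Finset.filter_filter]

/-! ### Step 4: the sieved counts are counts of orbits of forms with `Disc ≡ rs (8r)`, `q² ∣ Disc` -/

/-- No irreducible integral binary cubic form has discriminant `1`. [folklore] -/
theorem irredOrbitsOfDisc_one : irredOrbitsOfDisc 1 = ∅ := by
  ext O
  simp only [irredOrbitsOfDisc, Set.mem_setOf_eq, Set.mem_empty_iff_false, iff_false]
  rintro ⟨f, -, hirr, h1⟩
  exact hirr.disc_ne_one h1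

/-- **`N(S ∩ V^{(i)}; X)` for `S` cut out by a condition on the discriminant is a sum over the
window**: `irredOrbitCount s {f | P (Disc f)} X = Σ_{D ∈ discWindow s X, P D} #irredOrbitsOfDisc D`
(`X ∈ ℕ`). [folklore] -/
theorem irredOrbitCount_setOf_disc_eq_sum {s : ℤ} (hs : s = 1 ∨ s = -1) (P : ℤ → Prop)
    [DecidablePred P] (X : ℕ) :
    irredOrbitCount s {f : BinaryCubic ℤ | P f.disc} X =
      ∑ D ∈ (discWindow s X).filter P, Nat.card (irredOrbitsOfDisc D) := by
  have hset : {O : Set (BinaryCubic ℤ) | ∃ f ∈ {f : BinaryCubic ℤ | P f.disc},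
      O = gl2zOrbit f ∧ f.IsIrreducible ∧ 0 < s * f.disc ∧ ((s * f.disc : ℤ) : ℝ) < (X : ℝ)} =
      orbitsWith BinaryCubic.IsIrreducible (((discWindow s X).filter P : Finset ℤ) : Set ℤ) := by
    ext O
    constructor
    · rintro ⟨f, hf, rfl, hirr, h0, hX⟩
      refine ⟨f, rfl, hirr, ?_⟩
      rw [Finset.mem_coe, Finset.mem_filter, mem_discWindow hs]
      exact ⟨⟨h0, by exact_mod_cast hX⟩, hf⟩
    · rintro ⟨f, rfl, hirr, hF⟩
      rw [Finset.mem_coe, Finset.mem_filter, mem_discWindow hs] at hF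
      exact ⟨f, hF.2, rfl, hirr, hF.1.1, by exact_mod_cast hF.1.2⟩
  have h0 : (0 : ℤ) ∉ (discWindow s X).filter P := fun h =>
    zero_not_mem_discWindow hs X (Finset.mem_filter.1 h).1
  rw [irredOrbitCount, hset, ncard_orbitsWith_eq_sum _ _ h0]
  refine Finset.sum_congr rfl fun D _ => ?_
  rw [orbitsWith_isIrreducible_singleton, Nat.card_coe_set_eq]

/-- **Imaginary side, all the way down**: for an admissible type `(r, s)`,
`Σ_{−X<D<0 fund., D ≡ rs (8r)} #irredOrbitsOfDisc D = Σ_{q ≤ X odd} μ(q) · N⁻_q(X; r, s)` with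
`N⁻_q(X; r, s) = irredOrbitCount (-1) {f | Disc f ≡ rs (8r), q² ∣ Disc f} X` the number of
`GL₂(ℤ)`-orbits of irreducible integral binary cubic forms with `−X < Disc < 0` in the type class and
`q² ∣ Disc` (the irreducible part of Taniguchi–Thorne's `Σ_{n<X} a'_q(n)` with the local specification
at `2`; Bhargava–Taniguchi–Thorne's `N⁻(X, Φ ⊗ Ψ_{q²})`).
[cite: TaniguchiThorne2013, §6.1 and §6.3 (M₃^±(X, 𝒮) via the q-nonmaximal-or-totally-ramified counts)] -/
theorem sum_negFundDiscrs_type_irredOrbits_eq_sum_moebius {r : ℕ} {s : ℤ}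
    (hr : r ∈ ({1, 4, 8} : Finset ℕ)) (hs : s ∈ ({1, 3, 5, 7} : Finset ℤ))
    (he : ttLocalFactorTwo (r * s) = 1) (X : ℕ) :
    (∑ D ∈ (negFundDiscrs X).filter (fun D => D ≡ r * s [ZMOD ((8 * r : ℕ) : ℤ)]),
        (Nat.card (irredOrbitsOfDisc D) : ℤ)) =
      ∑ d ∈ (Icc 1 X).filter (fun d => ¬ 2 ∣ d), (μ d : ℤ) *
        (irredOrbitCount (-1)
          {f : BinaryCubic ℤ | f.disc ≡ r * s [ZMOD ((8 * r : ℕ) : ℤ)] ∧ (d : ℤ) ^ 2 ∣ f.disc} X : ℤ) := by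
  classical
  rw [sum_negFundDiscrs_type_eq_sum_moebius hr hs he (fun D => (Nat.card (irredOrbitsOfDisc D) : ℤ)) X]
  refine Finset.sum_congr rfl fun d _ => ?_
  rw [Int.cast_id, irredOrbitCount_setOf_disc_eq_sum (Or.inr rfl)
    (fun D => D ≡ r * s [ZMOD ((8 * r : ℕ) : ℤ)] ∧ (d : ℤ) ^ 2 ∣ D) X, Nat.cast_sum]

/-- **Real side, all the way down**: for an admissible type `(r, s)`,
`Σ_{0<D<X fund., D ≡ rs (8r)} #irredOrbitsOfDisc D = Σ_{q ≤ X odd} μ(q) · N⁺_q(X; r, s)`,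
`N⁺_q(X; r, s) = irredOrbitCount 1 {f | Disc f ≡ rs (8r), q² ∣ Disc f} X`.
[cite: TaniguchiThorne2013, §6.1 and §6.3 (M₃^±(X, 𝒮) via the q-nonmaximal-or-totally-ramified counts)] -/
theorem sum_posFundDiscrs_type_irredOrbits_eq_sum_moebius {r : ℕ} {s : ℤ}
    (hr : r ∈ ({1, 4, 8} : Finset ℕ)) (hs : s ∈ ({1, 3, 5, 7} : Finset ℤ))
    (he : ttLocalFactorTwo (r * s) = 1) (X : ℕ) :
    (∑ D ∈ (posFundDiscrs X).filter (fun D => D ≡ r * s [ZMOD ((8 * r : ℕ) : ℤ)]),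
        (Nat.card (irredOrbitsOfDisc D) : ℤ)) =
      ∑ d ∈ (Icc 1 X).filter (fun d => ¬ 2 ∣ d), (μ d : ℤ) *
        (irredOrbitCount 1
          {f : BinaryCubic ℤ | f.disc ≡ r * s [ZMOD ((8 * r : ℕ) : ℤ)] ∧ (d : ℤ) ^ 2 ∣ f.disc} X : ℤ) := by
  classical
  rw [sum_posFundDiscrs_type_eq_sum_moebius hr hs he (w := fun D => (Nat.card (irredOrbitsOfDisc D) : ℤ))
    (by simp [irredOrbitsOfDisc_one]) X]
  refine Finset.sum_congr rfl fun d _ => ?_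
  rw [Int.cast_id, irredOrbitCount_setOf_disc_eq_sum (Or.inl rfl)
    (fun D => D ≡ r * s [ZMOD ((8 * r : ℕ) : ℤ)] ∧ (d : ℤ) ^ 2 ∣ D) X, Nat.cast_sum]

end Literature.NumberTheory.CubicFields

end
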